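import Literature.AlgebraicGeometry.Frobenioids.CosetBaseEquivalenceObjects
import Literature.AnabelianGeometry.SemiGraphs.CosetCategoriesFSM
import Literature.AnabelianGeometry.SemiGraphs.CosetCategoriesPullConj
import HarnessLib

/-!
# An equivalence of small coset categories IS transport along the group isomorphism it induces

Mochizuki, *Semi-graphs of anabelioids*, Publ. RIMS **42** (2006), Proposition 3.2 p. 35 (the "Grothendieck
conjecture" for connected temperoids) [cite: MochizukiSemiAnbd2006, Prop 3.2 p.35]: "the category of morphisms
`𝒯₁ → 𝒯₂` is equivalent to the category whose objects are continuous group homomorphisms `φ : Π₁ → Π₂` and whose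
morphisms `φ → ψ` are elements `g ∈ Π₂` such that `γ_g ∘ φ = ψ`" — i.e. every morphism of temperoids IS (isomorphic to)
pull-back `𝓑^temp(φ)` along a continuous homomorphism; recalled in [IUTchI] §0 p. 35 and used in the proof of [IUTchI]
Cor. 5.3 (ii) p. 144. Mochizuki, *The geometry of Frobenioids II*, Kyushu J. Math. **62** (2008), Thm. 2.4 (ii) p. 21
[cite: MochizukiFrdII2008, Thm 2.4 (ii) p.21] ("`Ψ` induces `G₁ ⥲ G₂`").

PROOF-ONLY companion (theorems only; no definitions, no instances) of abc-iut-L5-t2's `CosetCategories*.lean` (the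
SMALL model `CosetCat Π` of `𝓑^temp(Π)⁰`, transport functor `CosetCat.pull`), of `CosetCategoriesPullConj.lean`
(transport functors vs inner automorphisms) and of abc-iut-L1's `PadicFrobenioidPairIso.lean` /
`CosetBaseEquivalenceObjects.lean` (an equivalence `E : CosetCat Π₁ ≌ CosetCat Π₂` INDUCES `φ : Π₁ ≃* Π₂`,
`BaseGaloisSystem.exists_mulEquiv_compatible_of_cosetCat_equivalence`: along a straightening
`ι : (Π₁/N_k)_k ⋙ E ≅ (Π₂/N₂,k)_k` of cofinal Galois pro-systems, `E(r_g) = r_{φ g}`; and `E(Π₁/U) ≅ Π₂/φ(U)` OBJECTWISE up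
to conjugacy).  Here the functor-level statement (cell abc-iut, node IUTchI:Cor5.3(ii), step C53ii/L04 (c); support,
not the row deliverable «C53ii/N2», whose `Inn`-injectivity theorems are abc-iut-w4-d078's
`Frobenioids/CosetBaseEquivalenceConj.lean` / `…Inner.lean` in `BaseGaloisSystem` currency):

* `CosetCat.nonempty_iso_pull_of_compatible` — **if `E` induces `φ` along ANY straightening, then `φ`, `φ⁻¹` are
  continuous and `E.functor ≅ pull φ⁻¹` (`Π₁/U ↦ Π₂/φ(U)`) as functors**: the component at `X = Π₁/U` sends the point
  `c_X·U'` of `Π₂/N₂,k ≅ E(Π₁/N_k) → E(X)` to `1·φ(U)`; independence of the level and naturality are tested against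
  these epimorphisms using the compatibility of `ι` with projections and right translations;
* `CosetCat.exists_continuousMulEquiv_nonempty_iso_pull` — hence every equivalence `CosetCat Π₁ ≌ CosetCat Π₂` (`Π₁`
  Galois-countable tempered, `Π₂` tempered) is isomorphic to transport along some `φ : Π₁ ≃ₜ* Π₂` (the converse of
  `CosetCat.nonempty_equivalence_of_continuousMulEquiv`).

Combined with `CosetCategoriesPullConj.lean` (`pull φ'⁻¹ ≅ pull φ⁻¹ ↔ φ' = Inn(x) ∘ φ`) this is a second route to the
printed "isomorphism classes of equivalences ↔ outer isomorphisms".  Pure topological-group / category theory over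
landed files; nothing of the disputed series is asserted; no side is taken on [IUTchIII] Cor. 3.12.
-/

noncomputable section

namespace Literature.AnabelianGeometry.SemiGraphs

open CategoryTheory Opposite _root_.Filter _root_.Topology
open Literature.AlgebraicGeometry.Frobenioids Literature.AlgebraicGeometry.Frobenioids.BaseGaloisSystem

universe u

namespace CosetCat

/-! ### An equivalence is transport along the group isomorphism it induces -/

section Induced

variable {G : Type u} [Group G] [TopologicalSpace G] [IsTopologicalGroup G]
  {G₂ : Type u} [Group G₂] [TopologicalSpace G₂] [IsTopologicalGroup G₂]

/-- **An equivalence of small coset categories IS transport along the group isomorphism it induces.**  Let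
`E : CosetCat Π₁ ≌ CosetCat Π₂`, `N` (resp. `N₂`) a cofinal antitone sequence of open normal subgroups of `Π₁`
(resp. `Π₂`), `ι` a straightening `(Π₁/N_k)_k ⋙ E ≅ (Π₂/N₂,k)_k` and `φ : Π₁ ≃* Π₂` INDUCED by `E` along `ι`
(`E(r_g) = r_{φ g}` under `ι`, the output of `BaseGaloisSystem.exists_mulEquiv_compatible_of_cosetCat_equivalence`).
Then `φ`, `φ⁻¹` are continuous and `E.functor ≅ pull φ⁻¹` (`G/U ↦ Π₂/φ(U)`): the component at `X = Π₁/U` is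
`E(X) ∋ c_X·U' ↦ 1·φ(U)`, where `Π₂/N₂,k ≅ E(Π₁/N_k) → E(X)` has point `c_X·U'`; it is independent of `k` and
natural by the compatibility of `ι` with projections and right translations.
[cite: MochizukiSemiAnbd2006, Prop 3.2 p.35] -/
theorem nonempty_iso_pull_of_compatible (E : CosetCat G ≌ CosetCat G₂) (N : ℕ → OpenNormalSubgroup G)
    (hN : Antitone N) (hNb : ∀ U ∈ 𝓝 (1 : G), ∃ k, (N k : Set G) ⊆ U) (N₂ : ℕ → OpenNormalSubgroup G₂)
    (hN₂ : Antitone N₂) (hN₂b : ∀ U ∈ 𝓝 (1 : G₂), ∃ k, (N₂ k : Set G₂) ⊆ U)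
    (ι : cosetSystem N hN ⋙ E.functor.op ≅ cosetSystem N₂ hN₂) (φ : G ≃* G₂)
    (hφ : ∀ g : G, toAutCoset N₂ hN₂ (φ g) =
      ι.conjAut ((Equivalence.congrRight (E := ℕ) E.op).functor.mapIso (toAutCoset N hN g))) :
    ∃ (_ : Continuous φ) (hφc' : Continuous φ.symm.toMonoidHom) (hφs : Function.Surjective φ.symm.toMonoidHom),
      Nonempty (E.functor ≅ pull φ.symm.toMonoidHom hφc' hφs) := by
  -- the straightening at level `k`: `j_k : Π₂/N₂,k ≅ E(Π₁/N_k)` with `r_{φ g} ≫ j_k = j_k ≫ E(r_g)`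
  let j : ∀ k : ℕ, cQ (N₂ k) ≅ E.functor.obj (cQ (N k)) := fun k => (ι.app k).unop
  have hcomm : ∀ (k : ℕ) (g : G),
      crightMul (N₂ k) (φ g) ≫ (j k).hom = (j k).hom ≫ E.functor.map (crightMul (N k) g) := by
    intro k g
    have h := congrArg (fun α : Aut (cosetSystem N₂ hN₂) => (α.hom.app k).unop) (hφ g)
    simp only [toAutCoset_hom_app, Iso.conjAut_hom, Iso.conj_apply, NatTrans.comp_app, unop_comp,
      Category.assoc] at h
    change crightMul (N₂ k) (φ g) = (j k).hom ≫ E.functor.map (crightMul (N k) g) ≫ (j k).inv at h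
    rw [h, Category.assoc, Category.assoc, Iso.inv_hom_id, Category.comp_id]
  -- `ι` is compatible with the projections
  have hjnat : ∀ {k k' : ℕ} (hkk' : k ≤ k'),
      (j k').hom ≫ E.functor.map (cproj (hN hkk')) = cproj (hN₂ hkk') ≫ (j k).hom := by
    intro k k' hkk'
    have h := congrArg Quiver.Hom.unop (ι.hom.naturality (homOfLE hkk' : k ⟶ k'))
    simp only [Functor.comp_map, Functor.op_map, cosetSystem_map, unop_comp] at h
    exact h
  -- `φ(N_k) = N₂,k`
  have hlevel : ∀ (k : ℕ) (g : G), φ g ∈ N₂ k ↔ g ∈ N k := by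
    intro k g
    rw [← crightMul_eq_id_iff, ← crightMul_eq_id_iff]
    constructor
    · intro h
      have h2 := hcomm k g
      rw [h, Category.id_comp] at h2
      have h3 : E.functor.map (crightMul (N k) g) = 𝟙 _ :=
        (cancel_epi (j k).hom).1 (by rw [← h2, Category.comp_id])
      exact E.functor.map_injective (by rw [h3, CategoryTheory.Functor.map_id])
    · intro h
      have h2 := hcomm k g
      rw [h, CategoryTheory.Functor.map_id, Category.comp_id] at h2
      exact (cancel_mono (j k).hom).1 (by rw [h2, Category.id_comp])
  -- continuity of `φ` and `φ⁻¹`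
  have hcont : Continuous φ := by
    refine continuous_of_continuousAt_one φ ?_
    rw [ContinuousAt, map_one]
    intro U hU
    obtain ⟨k, hk⟩ := hN₂b U hU
    exact Filter.mem_map.mpr
      (Filter.mem_of_superset ((N k).toOpenSubgroup.mem_nhds_one) fun g hg => hk ((hlevel k g).2 hg))
  have hcont' : Continuous φ.symm.toMonoidHom := by
    refine continuous_of_continuousAt_one φ.symm.toMonoidHom ?_
    rw [ContinuousAt, map_one]
    intro U hU
    obtain ⟨k, hk⟩ := hNb U hU
    refine Filter.mem_map.mpr (Filter.mem_of_superset ((N₂ k).toOpenSubgroup.mem_nhds_one) fun g hg => hk ?_)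
    exact (hlevel k (φ.symm g)).1 (by rw [MulEquiv.apply_symm_apply]; exact hg)
  have hsurj : Function.Surjective φ.symm.toMonoidHom := fun g => ⟨φ g, φ.symm_apply_apply g⟩
  refine ⟨hcont, hcont', hsurj, ?_⟩
  -- membership in `φ(U)` and points of `pull φ⁻¹` on morphisms
  have memP : ∀ (X : CosetCat G) (p : G₂),
      p ∈ ((pull φ.symm.toMonoidHom hcont' hsurj).obj X).sg ↔ φ.symm p ∈ X.sg :=
    fun X p => mem_pull_obj_sg _ _ _ X p
  have hPmap : ∀ {X Y : CosetCat G} (f : X ⟶ Y) {a : G}, pt f = (a : Y.carrier) →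
      pt ((pull φ.symm.toMonoidHom hcont' hsurj).map f) =
        ((φ a : G₂) : ((pull φ.symm.toMonoidHom hcont' hsurj).obj Y).carrier) :=
    fun f a ha => pt_pull_map_coe _ _ _ f ha (φ.symm_apply_apply a)
  -- a level `k_X` with `N_{k_X} ⊆ U` for every `X = Π₁/U`
  have hk : ∀ X : CosetCat G, ∃ k, (N k : Set G) ⊆ X.sg := fun X => hNb _ X.sg.mem_nhds_one
  choose kX hkX using hk
  -- the projections `q_{X,k} : Π₁/N_k → X` (point `1·U`) and `ε_{X,k} : Π₂/N₂,k → Π₂/φ(U)` (point `1·φ(U)`)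
  have hq0 : ∀ (X : CosetCat G) (k : ℕ), (N k : Set G) ⊆ X.sg →
      ∀ u ∈ (cQ (N k)).sg, u • ((1 : G) : X.carrier) = ((1 : G) : X.carrier) :=
    fun X k hk u hu => (smul_one_eq_one_iff X u).mpr (hk hu)
  have hε0 : ∀ (X : CosetCat G) (k : ℕ), (N k : Set G) ⊆ X.sg → ∀ u ∈ (cQ (N₂ k)).sg,
      u • ((1 : G₂) : ((pull φ.symm.toMonoidHom hcont' hsurj).obj X).carrier) =
        ((1 : G₂) : ((pull φ.symm.toMonoidHom hcont' hsurj).obj X).carrier) :=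
    fun X k hk u hu => (smul_one_eq_one_iff _ u).mpr ((memP X u).mpr
      (hk ((hlevel k (φ.symm u)).mp (by rw [MulEquiv.apply_symm_apply]; exact hu))))
  let q : ∀ (X : CosetCat G) (k : ℕ), (N k : Set G) ⊆ X.sg → (cQ (N k) ⟶ X) :=
    fun X k hk => homMk ((1 : G) : X.carrier) (hq0 X k hk)
  let ε : ∀ (X : CosetCat G) (k : ℕ), (N k : Set G) ⊆ X.sg →
      (cQ (N₂ k) ⟶ (pull φ.symm.toMonoidHom hcont' hsurj).obj X) :=
    fun X k hk => homMk ((1 : G₂) : _) (hε0 X k hk)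
  have hq : ∀ X k hk, pt (q X k hk) = ((1 : G) : X.carrier) := fun X k hk => pt_homMk _ _
  have hε : ∀ X k hk, pt (ε X k hk) =
      ((1 : G₂) : ((pull φ.symm.toMonoidHom hcont' hsurj).obj X).carrier) :=
    fun X k hk => pt_homMk _ _
  have hqproj : ∀ (X : CosetCat G) {k k' : ℕ} (hkk' : k ≤ k') (hk : (N k : Set G) ⊆ X.sg)
      (hk' : (N k' : Set G) ⊆ X.sg), q X k' hk' = cproj (hN hkk') ≫ q X k hk := fun X k k' hkk' hk hk' =>
    hom_ext (by rw [pt_comp, pt_cproj, toFun_coe, one_smul, hq X k hk, hq X k' hk'])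
  have hεproj : ∀ (X : CosetCat G) {k k' : ℕ} (hkk' : k ≤ k') (hk : (N k : Set G) ⊆ X.sg)
      (hk' : (N k' : Set G) ⊆ X.sg), ε X k' hk' = cproj (hN₂ hkk') ≫ ε X k hk := fun X k k' hkk' hk hk' =>
    hom_ext (by rw [pt_comp, pt_cproj, toFun_coe, one_smul, hε X k hk, hε X k' hk'])
  -- `c_X`: the point of `Π₂/N₂,k_X ≅ E(Π₁/N_{k_X}) → E(X)`
  have hcex : ∀ X : CosetCat G, ∃ c : G₂,
      pt ((j (kX X)).hom ≫ E.functor.map (q X (kX X) (hkX X))) = (c : (E.functor.obj X).carrier) := fun X => by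
    obtain ⟨c, hc⟩ := QuotientGroup.mk_surjective (pt ((j (kX X)).hom ≫ E.functor.map (q X (kX X) (hkX X))))
    exact ⟨c, hc.symm⟩
  choose c hc using hcex
  -- `E(X) = Π₂/c_X⁻¹·φ(U)·c_X`
  have hR : ∀ (X : CosetCat G) (g : G), g ∈ X.sg ↔ (c X)⁻¹ * φ g * c X ∈ (E.functor.obj X).sg := by
    intro X g
    have h1 : g ∈ X.sg ↔ crightMul (N (kX X)) g ≫ q X (kX X) (hkX X) = q X (kX X) (hkX X) := by
      rw [crightMul_comp_eq_self_iff (N (kX X)) (q X (kX X) (hkX X)) (hq X (kX X) (hkX X)), inv_one, one_mul,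
        mul_one]
    have key : crightMul (N₂ (kX X)) (φ g) ≫ ((j (kX X)).hom ≫ E.functor.map (q X (kX X) (hkX X))) =
        (j (kX X)).hom ≫ E.functor.map (crightMul (N (kX X)) g ≫ q X (kX X) (hkX X)) := by
      rw [← Category.assoc, hcomm, Category.assoc, ← CategoryTheory.Functor.map_comp]
    have h2 : crightMul (N₂ (kX X)) (φ g) ≫ ((j (kX X)).hom ≫ E.functor.map (q X (kX X) (hkX X))) =
        (j (kX X)).hom ≫ E.functor.map (q X (kX X) (hkX X)) ↔
        crightMul (N (kX X)) g ≫ q X (kX X) (hkX X) = q X (kX X) (hkX X) := by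
      rw [key]
      constructor
      · intro h
        exact E.functor.map_injective ((cancel_epi (j (kX X)).hom).1 h)
      · intro h
        rw [h]
    rw [h1, ← h2, crightMul_comp_eq_self_iff (N₂ (kX X)) _ (hc X)]
  -- the components `θ_X : E(X) → Π₂/φ(U)`, `c_X·U' ↦ 1·φ(U)`
  have hθ0 : ∀ (X : CosetCat G), ∀ s ∈ (E.functor.obj X).sg,
      s • (((c X)⁻¹ : G₂) : ((pull φ.symm.toMonoidHom hcont' hsurj).obj X).carrier) =
        (((c X)⁻¹ : G₂) : ((pull φ.symm.toMonoidHom hcont' hsurj).obj X).carrier) := by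
    intro X s hs
    rw [MulAction.Quotient.smul_coe, smul_eq_mul, QuotientGroup.eq,
      show (s * (c X)⁻¹)⁻¹ * (c X)⁻¹ = c X * s⁻¹ * (c X)⁻¹ by group]
    refine (memP X _).mpr ((hR X _).mpr ?_)
    rw [MulEquiv.apply_symm_apply, show (c X)⁻¹ * (c X * s⁻¹ * (c X)⁻¹) * c X = s⁻¹ by group]
    exact inv_mem hs
  let θ : ∀ X : CosetCat G, E.functor.obj X ⟶ (pull φ.symm.toMonoidHom hcont' hsurj).obj X :=
    fun X => homMk (((c X)⁻¹ : G₂) : _) (hθ0 X)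
  have hθ : ∀ X, pt (θ X) =
      (((c X)⁻¹ : G₂) : ((pull φ.symm.toMonoidHom hcont' hsurj).obj X).carrier) :=
    fun X => pt_homMk _ _
  -- characterisation of `θ_X` under `Π₂/N₂,k → E(X)`, first at the defining level, then at every level
  have hΘ0 : ∀ X : CosetCat G,
      (j (kX X)).hom ≫ E.functor.map (q X (kX X) (hkX X)) ≫ θ X = ε X (kX X) (hkX X) := fun X =>
    hom_ext (by
      rw [← Category.assoc, pt_comp, hc X, toFun_coe, hθ, MulAction.Quotient.smul_coe, smul_eq_mul,
        mul_inv_cancel, hε X (kX X) (hkX X)])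
  have hstep : ∀ (X : CosetCat G) {k k' : ℕ} (hkk' : k ≤ k') (hk : (N k : Set G) ⊆ X.sg)
      (hk' : (N k' : Set G) ⊆ X.sg), (j k').hom ≫ E.functor.map (q X k' hk') ≫ θ X =
        cproj (hN₂ hkk') ≫ ((j k).hom ≫ E.functor.map (q X k hk) ≫ θ X) := by
    intro X k k' hkk' hk hk'
    rw [hqproj X hkk' hk hk', CategoryTheory.Functor.map_comp]
    simp only [Category.assoc]
    rw [← Category.assoc, hjnat hkk', Category.assoc]
  have hΘ : ∀ (X : CosetCat G) (k : ℕ) (hk : (N k : Set G) ⊆ X.sg),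
      (j k).hom ≫ E.functor.map (q X k hk) ≫ θ X = ε X k hk := by
    intro X k hk
    have hm : (N (max k (kX X)) : Set G) ⊆ X.sg := fun g hg => hk (hN (le_max_left k (kX X)) hg)
    have hup : (j (max k (kX X))).hom ≫ E.functor.map (q X _ hm) ≫ θ X = ε X _ hm := by
      rw [hstep X (le_max_right k (kX X)) (hkX X) hm, hΘ0 X, ← hεproj X (le_max_right k (kX X)) (hkX X) hm]
    haveI : Epi (cproj (hN₂ (le_max_left k (kX X))) : cQ (N₂ (max k (kX X))) ⟶ cQ (N₂ k)) :=
      isTotallyEpimorphic.epi _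
    refine (cancel_epi (cproj (hN₂ (le_max_left k (kX X))) : cQ (N₂ (max k (kX X))) ⟶ cQ (N₂ k))).mp ?_
    rw [← hstep X (le_max_left k (kX X)) hk hm, hup, hεproj X (le_max_left k (kX X)) hk hm]
  -- the components are isomorphisms
  have hθiso : ∀ X, IsIso (θ X) := fun X => by
    refine isIso_of_bijective (θ X) ⟨fun y y' hyy' => ?_, fun z => ?_⟩
    · obtain ⟨s, rfl⟩ := QuotientGroup.mk_surjective y
      obtain ⟨t, rfl⟩ := QuotientGroup.mk_surjective y'
      rw [toFun_coe, toFun_coe, hθ, MulAction.Quotient.smul_coe, MulAction.Quotient.smul_coe, smul_eq_mul,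
        smul_eq_mul, QuotientGroup.eq] at hyy'
      have h3 : φ.symm ((s * (c X)⁻¹)⁻¹ * (t * (c X)⁻¹)) ∈ X.sg := (memP X _).mp hyy'
      have h4 := (hR X _).mp h3
      rw [MulEquiv.apply_symm_apply,
        show (c X)⁻¹ * ((s * (c X)⁻¹)⁻¹ * (t * (c X)⁻¹)) * c X = s⁻¹ * t by group] at h4
      exact QuotientGroup.eq.mpr h4
    · obtain ⟨p, rfl⟩ := QuotientGroup.mk_surjective z
      refine ⟨((p * c X : G₂) : (E.functor.obj X).carrier), ?_⟩
      rw [toFun_coe, hθ, MulAction.Quotient.smul_coe, smul_eq_mul, mul_inv_cancel_right]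
  -- naturality: test against the epimorphism `Π₂/N₂,k ≅ E(Π₁/N_k) → E(X)`
  refine ⟨NatIso.ofComponents (fun X => asIso (θ X)) ?_⟩
  intro X Y f
  change E.functor.map f ≫ θ Y = θ X ≫ (pull φ.symm.toMonoidHom hcont' hsurj).map f
  obtain ⟨a, ha⟩ := QuotientGroup.mk_surjective (pt f)
  have hkY : (N (kX X) : Set G) ⊆ Y.sg := fun n hn => by
    have hn' : n ∈ N (kX X) := hn
    have hu : a * n⁻¹ * a⁻¹ ∈ N (kX X) := (N (kX X)).isNormal'.conj_mem _ (inv_mem hn') a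
    have h2 := smul_pt f (hkX X hu)
    rw [← ha, MulAction.Quotient.smul_coe, smul_eq_mul, QuotientGroup.eq,
      show (a * n⁻¹ * a⁻¹ * a)⁻¹ * a = n by group] at h2
    exact h2
  have hqf : q X (kX X) (hkX X) ≫ f = crightMul (N (kX X)) a ≫ q Y (kX X) hkY :=
    hom_ext (by
      rw [pt_comp, pt_comp, hq X (kX X) (hkX X), pt_crightMul, toFun_coe, toFun_coe, hq Y (kX X) hkY, one_smul,
        MulAction.Quotient.smul_coe, smul_eq_mul, mul_one]
      exact ha.symm)
  haveI : Epi ((j (kX X)).hom ≫ E.functor.map (q X (kX X) (hkX X))) := isTotallyEpimorphic.epi _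
  refine (cancel_epi ((j (kX X)).hom ≫ E.functor.map (q X (kX X) (hkX X)))).mp ?_
  calc ((j (kX X)).hom ≫ E.functor.map (q X (kX X) (hkX X))) ≫ E.functor.map f ≫ θ Y
      = (j (kX X)).hom ≫ E.functor.map (q X (kX X) (hkX X) ≫ f) ≫ θ Y := by
        rw [CategoryTheory.Functor.map_comp]; simp only [Category.assoc]
    _ = (j (kX X)).hom ≫ E.functor.map (crightMul (N (kX X)) a) ≫ E.functor.map (q Y (kX X) hkY) ≫ θ Y := by
        rw [hqf, CategoryTheory.Functor.map_comp]; simp only [Category.assoc]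
    _ = crightMul (N₂ (kX X)) (φ a) ≫ ((j (kX X)).hom ≫ E.functor.map (q Y (kX X) hkY) ≫ θ Y) := by
        rw [← Category.assoc (j (kX X)).hom, ← hcomm (kX X) a]; simp only [Category.assoc]
    _ = crightMul (N₂ (kX X)) (φ a) ≫ ε Y (kX X) hkY := by rw [hΘ Y (kX X) hkY]
    _ = ε X (kX X) (hkX X) ≫ (pull φ.symm.toMonoidHom hcont' hsurj).map f :=
        hom_ext (by
          rw [pt_comp, pt_comp, pt_crightMul, toFun_coe, hε Y (kX X) hkY, hε X (kX X) (hkX X), toFun_coe,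
            one_smul, hPmap f ha.symm, MulAction.Quotient.smul_coe, smul_eq_mul, mul_one])
    _ = ((j (kX X)).hom ≫ E.functor.map (q X (kX X) (hkX X))) ≫ θ X ≫
          (pull φ.symm.toMonoidHom hcont' hsurj).map f := by
        rw [← Category.assoc, Category.assoc (j (kX X)).hom, hΘ X (kX X) (hkX X)]

/-- **Every equivalence of small coset categories is transport along a bicontinuous group isomorphism**
(`Π₁` Galois-countable tempered, `Π₂` tempered): `E.functor ≅ pull φ⁻¹` for some `φ : Π₁ ≃ₜ* Π₂` — the
essential surjectivity of "outer isomorphisms → isomorphism classes of equivalences" being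
`CosetCat.nonempty_equivalence_of_continuousMulEquiv`. [cite: MochizukiSemiAnbd2006, Prop 3.2 p.35] -/
theorem exists_continuousMulEquiv_nonempty_iso_pull [SecondCountableTopology G] (hG : IsTempered G)
    (hG₂ : IsTempered G₂) (E : CosetCat G ≌ CosetCat G₂) :
    ∃ (φ : G ≃ₜ* G₂) (hc : Continuous φ.symm.toMonoidHom) (hs : Function.Surjective φ.symm.toMonoidHom),
      Nonempty (E.functor ≅ pull φ.symm.toMonoidHom hc hs) := by
  obtain ⟨N, hN, hNb⟩ := exists_antitone_cofinal_seq hG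
  obtain ⟨N₂, hN₂, hN₂b, ι, φ, hφ⟩ := exists_mulEquiv_compatible_of_cosetCat_equivalence hG hG₂ N hN E hNb
  obtain ⟨hc, hc', hs, h⟩ := nonempty_iso_pull_of_compatible E N hN hNb N₂ hN₂ hN₂b ι φ hφ
  exact ⟨{ φ with continuous_toFun := hc, continuous_invFun := hc' }, hc', hs, h⟩

end Induced

end CosetCat

end Literature.AnabelianGeometry.SemiGraphs

end
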